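import Mathlib
import Literature.NumberTheory.LFunctions.Zhang2022.Section14Majorant1413
import Literature.NumberTheory.LFunctions.Zhang2022.Section14Summability
import HarnessLib

/-!
# Zhang (2022) §14, towards (14.6): the principal-character term at the modulus `D₂k` is `≪ d(D₁)⁴·P·𝓛ᶜ`
# — the u013 twin for a general factorisation `D = D₁D₂`, kernel-checked

Topic `Literature/NumberTheory/LFunctions/Zhang2022` (Landau–Siegel audit tree; verdict-neutral).
Y. Zhang, *Discrete mean estimates and the Landau–Siegel zero*, arXiv:2211.02515v1 (2022)
[Zhang2022LandauSiegel] — **an unrefereed manuscript under adjudication**; nothing here asserts or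
denies its Theorems 1–2 or Proposition 14.1. ZHANG-L discharge lane (helper under the leaf
`Skeleton.Prop141`, node `Z22:(14.6)` = `Typed.Sec14.Eq146`, GAP row G-adj2-4 "the (14.6) analogue").

In the character expansion of `𝒮(D₁,D₂;p)` at the modulus `D₂k` ((14.7)′,
`Section14Eq146CharExpansion.calS_charExpansion`) the principal character `θ = ψ⁰_{D₂k}` contributes
`Σ_d d⁻¹ Σ_{(k,D₁)=1} a*(dk)/(kφ(D₂k)) · τ(ψ̄⁰)ψ̄⁰(p) Σ_l κ*(D₁dl)ψ⁰(−l)Δ(l/(D₂pk))`. The manuscript's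
u013 (p. 78, tex L3928–L3930: "`τ(θ̄) = μ(Dk)` … by Lemma 5.3, `≪ P𝓛ᶜ`, which is admissible") treats
the case `(D₁,D₂) = (1,D)`; for (14.6) ("similar", p. 79) the same bound is needed at `D₂k` with the
shifted coefficients `κ*(D₁·)`, where (14.1) `|κ*(m)| ≤ Bτ₅(m)` costs the extra factor
`τ₅(D₁dl) ≤ d(D₁)⁴d(d)⁴d(l)⁴`. PROVED here (theorems only, no Assumption (A), no new definitions):

* `norm_princTerm₂_le_major₂` — the u013a twin: `|principal term| ≤` the majorant
  `Σ_d d⁻¹ Σ_{k≤2P₄} Σ_l |κ*(D₁dl)a*(dk)|/(φ(D₂k)k)·|Δ(l/(D₂pk))|` (`|τ(ψ̄⁰_{D₂k})| = |μ(D₂k)| ≤ 1`,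
  `|ψ⁰| ≤ 1`, the constraint `(k,D₁) = 1` dropped from a sum of non-negative terms).
* `tsum_majorant_inner_le₂`, `major₂_le` — the u013b twin: the majorant is
  `≤ 18·2¹⁷·B²·d(D₁)⁴·K_W·P·𝓛⁸⁴⁵` for `D` large, `p ∼ P`, `D₂ ≤ D`, under (14.1)–(14.2)
  (`K_W = (2C₅₃⁺+3)7¹⁶ + 4C₅₃⁺` from the tree's window lemma `tsum_divisors_pow_mul_norm_DeltaW_le` at
  `X = D₂pk`, `D₂k/φ(D₂k) ≤ 9𝓛¹⁸`, and the tree's `majorant_sum_le`).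
* `princTerm₂_bound` — both combined, in the eventual form the (14.6) assembly consumes:
  `∀ B, ∃ C, ∃ D₀, ∀ D ≥ D₀, ∀ p ∼ P, … ‖principal term‖ ≤ C·d(D₁)⁴·P·𝓛⁸⁴⁵`.

The factor `d(D₁)⁴ ≤ d(D)⁴ ≪ D^{ε}` is absorbed by the `D^{1/2−c}` of (14.6) downstream (divisor bound).

## References

* Y. Zhang, arXiv:2211.02515v1 (2022), §14 p. 78 (u013), p. 79 ((14.6) proof), §5 Lemma 5.3 p. 25.
  [cite: Zhang2022LandauSiegel, §14 u013 p.78, (14.6) p.79]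
-/

noncomputable section

open Complex Real ComplexConjugate

namespace Literature.NumberTheory.LFunctions.Zhang2022.Typed.Sec14

open Skeleton

/-! ## Arithmetic helpers: `τ₅ ≤ d⁴`, `d(mn) ≤ d(m)d(n)`, `D₂k/φ(D₂k) ≤ 9𝓛¹⁸` -/

/-- `τ_{j+1}(n) ≤ d(n)^j`. [folklore] -/
private theorem zeta_pow_succ_apply_le_card_divisors_pow' (j : ℕ) {n : ℕ} (hn : n ≠ 0) :
    (ArithmeticFunction.zeta ^ (j + 1) : ArithmeticFunction ℕ) n ≤ n.divisors.card ^ j := by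
  induction j generalizing n with
  | zero =>
      rw [zero_add, pow_one, ArithmeticFunction.zeta_apply, if_neg hn, pow_zero]
  | succ j ih =>
      rw [pow_succ, ArithmeticFunction.mul_zeta_apply]
      calc ∑ i ∈ n.divisors, (ArithmeticFunction.zeta ^ (j + 1) : ArithmeticFunction ℕ) i
          ≤ ∑ i ∈ n.divisors, n.divisors.card ^ j := by
            refine Finset.sum_le_sum fun i hi => ?_
            have hi0 : i ≠ 0 := Nat.pos_iff_ne_zero.mp (Nat.pos_of_mem_divisors hi)
            refine (ih hi0).trans (Nat.pow_le_pow_left ?_ j)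
            exact Finset.card_le_card (Nat.divisors_subset_of_dvd hn (Nat.dvd_of_mem_divisors hi))
        _ = n.divisors.card ^ (j + 1) := by rw [Finset.sum_const, smul_eq_mul, pow_succ']

/-- `τ₅(n) ≤ d(n)⁴` (as reals; trivially for `n = 0`). [folklore] -/
private theorem zeta_pow_five_le_card_divisors_pow_four' (n : ℕ) :
    (((ArithmeticFunction.zeta ^ 5 : ArithmeticFunction ℕ) n : ℕ) : ℝ) ≤ (n.divisors.card : ℝ) ^ 4 := by
  rcases eq_or_ne n 0 with rfl | hn
  · simp
  · exact_mod_cast zeta_pow_succ_apply_le_card_divisors_pow' 4 hn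

/-- `d(mn) ≤ d(m)d(n)`. [folklore] -/
private theorem card_divisors_mul_le' (m n : ℕ) :
    (m * n).divisors.card ≤ m.divisors.card * n.divisors.card := by
  rw [Nat.divisors_mul]
  exact Finset.card_mul_le

/-- `D₂k/φ(D₂k) ≤ 9𝓛¹⁸` when `1 ≤ D₂ ≤ D`, `log k ≤ 𝓛⁹` and `𝓛 = log D ≥ 1` (the tree's
`Sieve.natCast_div_totient_le`: `n/φ(n) ≤ (1 + log n)²`). [folklore] -/
private theorem natCast_mul_div_totient_le₂ {D D₂ k : ℕ} (hℓ1 : 1 ≤ ell D) (hD₂0 : (0 : ℝ) < D₂)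
    (hD₂D : (D₂ : ℝ) ≤ D) (hk0 : (0 : ℝ) < k) (hlogk : Real.log k ≤ ell D ^ 9) :
    ((D₂ * k : ℕ) : ℝ) / Nat.totient (D₂ * k) ≤ 9 * ell D ^ 18 := by
  refine (Literature.NumberTheory.Sieve.natCast_div_totient_le (D₂ * k)).trans ?_
  have h1 : Real.log ((D₂ * k : ℕ) : ℝ) ≤ 2 * ell D ^ 9 := by
    push_cast
    rw [Real.log_mul hD₂0.ne' hk0.ne']
    have h5 : ell D ≤ ell D ^ 9 := le_self_pow₀ hℓ1 (by norm_num)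
    have h2 : Real.log (D₂ : ℝ) ≤ ell D := by
      rw [ell]; exact Real.log_le_log hD₂0 hD₂D
    linarith
  have h0 : 0 ≤ 1 + Real.log ((D₂ * k : ℕ) : ℝ) := by
    have : 0 ≤ Real.log ((D₂ * k : ℕ) : ℝ) := Real.log_natCast_nonneg _; linarith
  have h9 : (1 : ℝ) ≤ ell D ^ 9 := one_le_pow₀ hℓ1
  nlinarith

/-! ## The `l`-series of the majorant at fixed `d, k` (modulus `D₂k`, coefficients `κ*(D₁·)`) -/

/-- **The `l`-series of the majorant at fixed `d, k`, modulus `D₂k`**: under (14.1)–(14.2) and Lemma 5.3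
at `D` (`𝓛 ≥ 3`), for `p < 2P`, `1 ≤ k ≤ P`, `1 ≤ D₂ ≤ D`,
`Σ_l |κ*(D₁dl)a*(dk)|/(φ(D₂k)k)·|Δ(l/(D₂pk))| ≤ B²·K_W·𝓛⁶⁷⁴·p·9𝓛¹⁸·d(D₁d)⁴/k`
(`K_W = (2C+3)7¹⁶ + 4C`; the tree's window lemma at `X = D₂pk`) — the twin of `tsum_majorant_inner_le`.
[cite: Zhang2022LandauSiegel, §14 u013 p.78, (14.6) p.79] -/
theorem tsum_majorant_inner_le₂ {D : ℕ} {c C : ℝ} (hc : 0 ≤ c) (hC : 0 ≤ C)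
    (hℓ3 : 3 ≤ ell D)
    (h53 : ∀ x : ℝ, 0 < x →
      (x ≤ t0 D ^ (1.02 : ℝ) → ‖DeltaW D x - omegaW D (1 / 2 + 2 * π * x * I)‖ ≤
          C * alpha D * ‖omegaW D (1 / 2 + 2 * π * x * I)‖ + Real.exp (-c * ell D ^ 10)) ∧
      (t0 D ^ (1.02 : ℝ) < x → ‖DeltaW D x‖ ≤
        C * (Real.exp (-((1 : ℝ) / 100 * ell2 D * Real.log x) ^ 2) +
          Real.exp (-(x ^ (0.99 : ℝ)) / ell2 D))))
    {B : ℝ} (hB0 : 0 ≤ B) {κs as : ℕ → ℂ} (h141 : Eq141 B κs) (h142 : Eq142 D B as)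
    {p : ℕ} (hp1 : (1 : ℝ) ≤ p) (hp2P : (p : ℝ) < 2 * bigP D) {D₁ D₂ d k : ℕ}
    (hD₂1 : 1 ≤ D₂) (hD₂D : D₂ ≤ D) (hk1 : 1 ≤ k) (hkP : (k : ℝ) ≤ bigP D) :
    (∑' l : ℕ, ‖κs (D₁ * d * l) * as (d * k)‖ / ((Nat.totient (D₂ * k) : ℝ) * k) *
        ‖DeltaW D ((l : ℝ) / ((D₂ : ℝ) * p * k))‖) ≤
      B ^ 2 * ((2 * C + 3) * 7 ^ 16 + 4 * C) * ell D ^ 674 * p * (9 * ell D ^ 18) *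
        ((((D₁ * d).divisors.card : ℝ)) ^ 4 / k) := by
  have hℓ1 : 1 ≤ ell D := by linarith
  have hD₂0 : (0 : ℝ) < D₂ := by exact_mod_cast hD₂1
  have hD₂1r : (1 : ℝ) ≤ D₂ := by exact_mod_cast hD₂1
  have hD₂Dr : (D₂ : ℝ) ≤ D := by exact_mod_cast hD₂D
  have hP0 : 0 < bigP D := Real.exp_pos _
  have hlogP : Real.log (bigP D) = ell D ^ 9 := by rw [bigP, Real.log_exp]
  have hk0 : (0 : ℝ) < k := by exact_mod_cast hk1
  have hk1r : (1 : ℝ) ≤ k := by exact_mod_cast hk1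
  have hDk0 : 0 < D₂ * k := Nat.mul_pos hD₂1 hk1
  have hφ0 : (0 : ℝ) < Nat.totient (D₂ * k) := by exact_mod_cast Nat.totient_pos.mpr hDk0
  have hlogk : Real.log k ≤ ell D ^ 9 := by rw [← hlogP]; exact Real.log_le_log hk0 hkP
  set W : ℝ := (2 * C + 3) * 7 ^ 16 + 4 * C with hW
  set X : ℝ := (D₂ : ℝ) * p * k with hX
  have hX1 : 1 ≤ X := by
    rw [hX]
    have h1 : (1 : ℝ) ≤ (D₂ : ℝ) * p := by nlinarith
    nlinarith
  have hX0 : 0 < X := by linarith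
  have hlogX : Real.log X ≤ 5 * ell D ^ 9 := by
    rw [hX, Real.log_mul (by positivity) hk0.ne', Real.log_mul hD₂0.ne' (by linarith)]
    have h1 : Real.log (D₂ : ℝ) ≤ ell D := by rw [ell]; exact Real.log_le_log hD₂0 hD₂Dr
    have h2 : Real.log p ≤ Real.log 2 + ell D ^ 9 := by
      rw [← hlogP, ← Real.log_mul (by norm_num) hP0.ne']
      exact Real.log_le_log (by linarith) hp2P.le
    have h4 : Real.log 2 ≤ 1 := by
      have := Real.log_two_lt_d9; linarith
    have h5 : ell D ≤ ell D ^ 9 := le_self_pow₀ hℓ1 (by norm_num)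
    linarith
  obtain ⟨hsum, hwin⟩ := tsum_divisors_pow_mul_norm_DeltaW_le hc hC hℓ3 h53 hX1 hlogX
  -- pointwise domination of the summand
  set A : ℝ := B ^ 2 * (((D₁ * d).divisors.card : ℝ)) ^ 4 / ((Nat.totient (D₂ * k) : ℝ) * k) with hA
  have hA0 : 0 ≤ A := by rw [hA]; positivity
  have hpt : ∀ l : ℕ, ‖κs (D₁ * d * l) * as (d * k)‖ / ((Nat.totient (D₂ * k) : ℝ) * k) *
      ‖DeltaW D ((l : ℝ) / X)‖ ≤ A * ((l.divisors.card : ℝ) ^ 4 * ‖DeltaW D ((l : ℝ) / X)‖) := by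
    intro l
    have hκ : ‖κs (D₁ * d * l)‖ ≤
        B * ((((D₁ * d).divisors.card : ℝ)) ^ 4 * (l.divisors.card : ℝ) ^ 4) := by
      refine (h141 (D₁ * d * l)).trans (mul_le_mul_of_nonneg_left ?_ hB0)
      refine (zeta_pow_five_le_card_divisors_pow_four' (D₁ * d * l)).trans ?_
      rw [← mul_pow]
      gcongr
      exact_mod_cast card_divisors_mul_le' (D₁ * d) l
    have ha : ‖as (d * k)‖ ≤ B := h142.1 _
    have hprod : ‖κs (D₁ * d * l) * as (d * k)‖ ≤
        B ^ 2 * (((D₁ * d).divisors.card : ℝ)) ^ 4 * (l.divisors.card : ℝ) ^ 4 := by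
      rw [norm_mul]
      calc ‖κs (D₁ * d * l)‖ * ‖as (d * k)‖
          ≤ (B * ((((D₁ * d).divisors.card : ℝ)) ^ 4 * (l.divisors.card : ℝ) ^ 4)) * B :=
            mul_le_mul hκ ha (norm_nonneg _) (by positivity)
        _ = B ^ 2 * (((D₁ * d).divisors.card : ℝ)) ^ 4 * (l.divisors.card : ℝ) ^ 4 := by ring
    have hq0 : (0 : ℝ) < (Nat.totient (D₂ * k) : ℝ) * k := by positivity
    rw [hA, div_mul_eq_mul_div, div_mul_eq_mul_div, div_le_div_iff_of_pos_right hq0]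
    calc ‖κs (D₁ * d * l) * as (d * k)‖ * ‖DeltaW D ((l : ℝ) / X)‖
        ≤ (B ^ 2 * (((D₁ * d).divisors.card : ℝ)) ^ 4 * (l.divisors.card : ℝ) ^ 4) *
            ‖DeltaW D ((l : ℝ) / X)‖ := by
          gcongr
      _ = _ := by ring
  have hpt0 : ∀ l : ℕ, 0 ≤ ‖κs (D₁ * d * l) * as (d * k)‖ / ((Nat.totient (D₂ * k) : ℝ) * k) *
      ‖DeltaW D ((l : ℝ) / X)‖ := fun l => by positivity
  have hmaj : Summable (fun l : ℕ => A * ((l.divisors.card : ℝ) ^ 4 * ‖DeltaW D ((l : ℝ) / X)‖)) :=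
    hsum.mul_left A
  have hfs : Summable (fun l : ℕ => ‖κs (D₁ * d * l) * as (d * k)‖ /
      ((Nat.totient (D₂ * k) : ℝ) * k) * ‖DeltaW D ((l : ℝ) / X)‖) :=
    Summable.of_nonneg_of_le hpt0 hpt hmaj
  have hφ : ((D₂ * k : ℕ) : ℝ) / Nat.totient (D₂ * k) ≤ 9 * ell D ^ 18 :=
    natCast_mul_div_totient_le₂ hℓ1 hD₂0 hD₂Dr hk0 hlogk
  have hAX : A * (W * X * ell D ^ 674) =
      B ^ 2 * W * ell D ^ 674 * p * (((D₂ * k : ℕ) : ℝ) / Nat.totient (D₂ * k)) *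
        ((((D₁ * d).divisors.card : ℝ)) ^ 4 / k) := by
    rw [hA, hX]; push_cast
    field_simp
  calc (∑' l : ℕ, ‖κs (D₁ * d * l) * as (d * k)‖ / ((Nat.totient (D₂ * k) : ℝ) * k) *
        ‖DeltaW D ((l : ℝ) / X)‖)
      ≤ ∑' l : ℕ, A * ((l.divisors.card : ℝ) ^ 4 * ‖DeltaW D ((l : ℝ) / X)‖) :=
        hfs.tsum_le_tsum hpt hmaj
    _ = A * ∑' l : ℕ, (l.divisors.card : ℝ) ^ 4 * ‖DeltaW D ((l : ℝ) / X)‖ := tsum_mul_left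
    _ ≤ A * (W * X * ell D ^ 674) := mul_le_mul_of_nonneg_left hwin hA0
    _ = B ^ 2 * W * ell D ^ 674 * p * (((D₂ * k : ℕ) : ℝ) / Nat.totient (D₂ * k)) *
          ((((D₁ * d).divisors.card : ℝ)) ^ 4 / k) := hAX
    _ ≤ B ^ 2 * W * ell D ^ 674 * p * (9 * ell D ^ 18) *
          ((((D₁ * d).divisors.card : ℝ)) ^ 4 / k) := by
        gcongr

/-! ## The majorant summed over `d, k`: `≪ d(D₁)⁴·P·𝓛⁸⁴⁵` -/

/-- **The u013b twin at the modulus `D₂k`**: for every `B` there are `C` and `D₀` such that for all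
`D ≥ D₀`, every `p ∼ P`, all `κ*, a*` subject to (14.1)–(14.2) and every `D₁` and `1 ≤ D₂ ≤ D`,
`Σ_d d⁻¹ Σ_{k≤2P₄} Σ_l |κ*(D₁dl)a*(dk)|/(φ(D₂k)k)·|Δ(l/(D₂pk))| ≤ C·d(D₁)⁴·P·𝓛⁸⁴⁵`, with
`C = 18·2¹⁷·B²·((2C₅₃⁺+3)7¹⁶ + 4C₅₃⁺)` (`C₅₃` the constant of the tree's discharged Lemma 5.3,
`Skeleton.lemma53_holds`); `d(D₁d) ≤ d(D₁)d(d)` and the tree's `majorant_sum_le`. Assumption (A) is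
not used. [cite: Zhang2022LandauSiegel, §14 u013 p.78, (14.6) p.79] -/
theorem major₂_le (B : ℝ) : ∃ C : ℝ, 0 ≤ C ∧ ∃ D₀ : ℕ, ∀ D : ℕ, D₀ ≤ D →
    ∀ (_ : NeZero D) (χ : DirichletCharacter ℂ D), χ.IsQuadratic → χ.IsPrimitive →
    ∀ p ∈ primeWindow D, ∀ κs as : ℕ → ℂ, Eq141 B κs → Eq142 D B as →
      ∀ D₁ D₂ : ℕ, 1 ≤ D₂ → D₂ ≤ D →
        ∑ d ∈ Finset.Icc 1 ⌊2 * P4 D⌋₊, (d : ℝ)⁻¹ * ∑ k ∈ Finset.Icc 1 ⌊2 * P4 D⌋₊,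
          ∑' l : ℕ, ‖κs (D₁ * d * l) * as (d * k)‖ / ((Nat.totient (D₂ * k) : ℝ) * k) *
            ‖DeltaW D ((l : ℝ) / ((D₂ : ℝ) * p * k))‖ ≤
          C * (D₁.divisors.card : ℝ) ^ 4 * bigP D * ell D ^ (845 : ℕ) := by
  obtain ⟨c53, hc53, C53, D₅₃, h53⟩ := lemma53_holds
  obtain ⟨Dl, hDl⟩ := exists_two_mul_P4_le_bigP
  have hC₀0 : 0 ≤ max C53 0 := le_max_right _ _
  have hW0 : 0 ≤ (2 * max C53 0 + 3) * 7 ^ 16 + 4 * max C53 0 := by positivity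
  refine ⟨18 * 2 ^ 17 * B ^ 2 * ((2 * max C53 0 + 3) * 7 ^ 16 + 4 * max C53 0), by positivity,
    max (max D₅₃ Dl) ⌈Real.exp 3⌉₊, fun D hD _ χ hq hprim p hpW κs as h141 h142 D₁ D₂ hD₂1 hD₂D => ?_⟩
  have hD₅₃ : D₅₃ ≤ D := le_trans (le_trans (le_max_left _ _) (le_max_left _ _)) hD
  have hDl' : Dl ≤ D := le_trans (le_trans (le_max_right _ _) (le_max_left _ _)) hD
  have hD3 : ⌈Real.exp 3⌉₊ ≤ D := le_trans (le_max_right _ _) hD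
  -- `𝓛 ≥ 3`
  have hDe : Real.exp 3 ≤ D := le_trans (Nat.le_ceil _) (by exact_mod_cast hD3)
  have hD0 : (0 : ℝ) < D := lt_of_lt_of_le (Real.exp_pos 3) hDe
  have hℓ3 : 3 ≤ ell D := by rw [ell, Real.le_log_iff_exp_le hD0]; exact hDe
  have hℓ1 : 1 ≤ ell D := by linarith
  -- Lemma 5.3 at `D`, with the nonnegative constant `max C₅₃ 0`
  have h53D : ∀ x : ℝ, 0 < x →
      (x ≤ t0 D ^ (1.02 : ℝ) → ‖DeltaW D x - omegaW D (1 / 2 + 2 * π * x * I)‖ ≤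
          max C53 0 * alpha D * ‖omegaW D (1 / 2 + 2 * π * x * I)‖ + Real.exp (-c53 * ell D ^ 10)) ∧
      (t0 D ^ (1.02 : ℝ) < x → ‖DeltaW D x‖ ≤
        max C53 0 * (Real.exp (-((1 : ℝ) / 100 * ell2 D * Real.log x) ^ 2) +
          Real.exp (-(x ^ (0.99 : ℝ)) / ell2 D))) := by
    intro x hx
    have h := h53 D χ hD₅₃ hq hprim x hx
    have hα0 : 0 ≤ alpha D := by
      rw [alpha, bigP, Real.log_exp]
      exact div_nonneg Real.pi_pos.le (pow_nonneg (Real.log_natCast_nonneg D) 9)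
    have hω0 : 0 ≤ ‖omegaW D (1 / 2 + 2 * π * x * I)‖ := norm_nonneg _
    have he0 : 0 ≤ Real.exp (-((1 : ℝ) / 100 * ell2 D * Real.log x) ^ 2) +
        Real.exp (-(x ^ (0.99 : ℝ)) / ell2 D) := by positivity
    refine ⟨fun hx1 => (h.1 hx1).trans ?_, fun hx2 => (h.2 hx2).trans ?_⟩
    · have : C53 * alpha D * ‖omegaW D (1 / 2 + 2 * π * x * I)‖ ≤
          max C53 0 * alpha D * ‖omegaW D (1 / 2 + 2 * π * x * I)‖ :=
        mul_le_mul_of_nonneg_right (mul_le_mul_of_nonneg_right (le_max_left _ _) hα0) hω0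
      linarith
    · exact mul_le_mul_of_nonneg_right (le_max_left _ _) he0
  -- data of the window
  have hp : p.Prime := (Finset.mem_filter.mp hpW).2
  have hp1 : (1 : ℝ) ≤ p := by exact_mod_cast hp.one_lt.le
  have hp2P : (p : ℝ) < 2 * bigP D := Section7MainTerm.lt_two_mul_bigP_of_mem_primeWindow hℓ1 hpW
  have hP0 : 0 < bigP D := Real.exp_pos _
  have hlogP : Real.log (bigP D) = ell D ^ 9 := by rw [bigP, Real.log_exp]
  have hB0 : 0 ≤ B := (norm_nonneg _).trans (h142.1 0)
  have hKP : (⌊2 * P4 D⌋₊ : ℝ) ≤ bigP D := by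
    have h0 : 0 ≤ 2 * P4 D := by
      have : 0 ≤ P4 D := by
        rw [P4, t0]
        exact mul_nonneg (div_nonneg hP0.le (pow_nonneg (Real.exp_pos _).le 2))
          (pow_nonneg (Real.log_natCast_nonneg D) 519)
      linarith
    exact (Nat.floor_le h0).trans (hDl D hDl')
  have hlogK1 : 1 + Real.log (⌊2 * P4 D⌋₊ : ℕ) ≤ 2 * ell D ^ 9 := by
    have h9 : (1 : ℝ) ≤ ell D ^ 9 := one_le_pow₀ hℓ1
    have hlogK : Real.log (⌊2 * P4 D⌋₊ : ℕ) ≤ ell D ^ 9 := by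
      rcases Nat.eq_zero_or_pos ⌊2 * P4 D⌋₊ with h0 | hpos
      · rw [h0, Nat.cast_zero, Real.log_zero]; positivity
      · rw [← hlogP]; exact Real.log_le_log (by exact_mod_cast hpos) hKP
    linarith
  -- `majorant_sum_le` with `B' = B·d(D₁)²` (so that `B'² = B²d(D₁)⁴`)
  set B' : ℝ := B * (D₁.divisors.card : ℝ) ^ 2 with hB'
  have hmain := majorant_sum_le (D := D) (p := p) (K := ⌊2 * P4 D⌋₊) (B := B') hW0 hℓ1 hp2P hlogK1
    (fun d k => ∑' l : ℕ, ‖κs (D₁ * d * l) * as (d * k)‖ / ((Nat.totient (D₂ * k) : ℝ) * k) *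
      ‖DeltaW D ((l : ℝ) / ((D₂ : ℝ) * p * k))‖) (fun d hd k hk => by
      obtain ⟨hk1, hkK⟩ := Finset.mem_Icc.mp hk
      have hkP : (k : ℝ) ≤ bigP D := le_trans (by exact_mod_cast hkK) hKP
      refine (tsum_majorant_inner_le₂ hc53.le hC₀0 hℓ3 h53D hB0 h141 h142 hp1 hp2P hD₂1 hD₂D
        hk1 hkP).trans ?_
      have hdiv : (((D₁ * d).divisors.card : ℝ)) ^ 4 ≤
          ((D₁.divisors.card : ℝ) ^ 2) ^ 2 * (d.divisors.card : ℝ) ^ 4 := by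
        rw [← pow_mul, show 2 * 2 = 4 by norm_num, ← mul_pow]
        gcongr
        exact_mod_cast card_divisors_mul_le' D₁ d
      have hk0 : (0 : ℝ) < k := by exact_mod_cast hk1
      have hrest : 0 ≤ B ^ 2 * ((2 * max C53 0 + 3) * 7 ^ 16 + 4 * max C53 0) * ell D ^ 674 * p *
          (9 * ell D ^ 18) := by positivity
      calc B ^ 2 * ((2 * max C53 0 + 3) * 7 ^ 16 + 4 * max C53 0) * ell D ^ 674 * p *
            (9 * ell D ^ 18) * ((((D₁ * d).divisors.card : ℝ)) ^ 4 / k)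
          ≤ B ^ 2 * ((2 * max C53 0 + 3) * 7 ^ 16 + 4 * max C53 0) * ell D ^ 674 * p *
            (9 * ell D ^ 18) * (((D₁.divisors.card : ℝ) ^ 2) ^ 2 * (d.divisors.card : ℝ) ^ 4 / k) := by
            gcongr
        _ = B' ^ 2 * ((2 * max C53 0 + 3) * 7 ^ 16 + 4 * max C53 0) * ell D ^ 674 * p *
            (9 * ell D ^ 18) * ((d.divisors.card : ℝ) ^ 4 / k) := by rw [hB']; ring)
  refine hmain.trans (le_of_eq ?_)
  rw [hB']; ring

/-! ## The principal-character term and its bound -/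

/-- **The u013a twin at the modulus `D₂k`**: the principal-character term of (14.7)′ is bounded by the
majorant, `|τ(ψ̄⁰_{D₂k})| = |μ(D₂k)| ≤ 1` (`step14p78_holds`), `|ψ⁰(p)|, |ψ⁰(−l)| ≤ 1`, the `l`-series
converging absolutely under (14.1) for `D ≥ 3` (`summable_kappa_mul_DeltaW`), and the constraint
`(k,D₁) = 1` dropped from a sum of non-negative terms. [cite: Zhang2022LandauSiegel, §14 u013 p.78, (14.6) p.79] -/
theorem norm_princTerm₂_le_major₂ {D : ℕ} (hD3 : 3 ≤ D) {B : ℝ} {κs : ℕ → ℂ} (hκ : Eq141 B κs)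
    (as : ℕ → ℂ) {p : ℕ} (hp : p ∈ primeWindow D) (D₁ D₂ : ℕ) (hD₂ : 1 ≤ D₂) :
    ‖∑ d ∈ Finset.Icc 1 ⌊2 * P4 D⌋₊, (d : ℂ)⁻¹ *
        ∑ k ∈ (Finset.Icc 1 ⌊2 * P4 D⌋₊).filter (fun k => Nat.Coprime k D₁),
          as (d * k) / ((k : ℂ) * Nat.totient (D₂ * k)) *
            (tauSum (D₂ * k) (1 : DirichletCharacter ℂ (D₂ * k))⁻¹ *
                (1 : DirichletCharacter ℂ (D₂ * k))⁻¹ (p : ZMod (D₂ * k)) *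
              ∑' l : ℕ, κs (D₁ * d * l) * (1 : DirichletCharacter ℂ (D₂ * k)) (-(l : ZMod (D₂ * k))) *
                DeltaW D ((l : ℝ) / ((D₂ : ℝ) * p * k)))‖ ≤
      ∑ d ∈ Finset.Icc 1 ⌊2 * P4 D⌋₊, (d : ℝ)⁻¹ * ∑ k ∈ Finset.Icc 1 ⌊2 * P4 D⌋₊,
        ∑' l : ℕ, ‖κs (D₁ * d * l) * as (d * k)‖ / ((Nat.totient (D₂ * k) : ℝ) * k) *
          ‖DeltaW D ((l : ℝ) / ((D₂ : ℝ) * p * k))‖ := by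
  have hprime : p.Prime := (Finset.mem_filter.mp hp).2
  refine (norm_sum_le _ _).trans (Finset.sum_le_sum fun d _ => ?_)
  rw [norm_mul, norm_inv, Complex.norm_natCast]
  refine mul_le_mul_of_nonneg_left ?_ (by positivity)
  -- per-`k` bound by the non-negative majorant term, then drop the filter
  have hF0 : ∀ k ∈ Finset.Icc 1 ⌊2 * P4 D⌋₊, 0 ≤
      ∑' l : ℕ, ‖κs (D₁ * d * l) * as (d * k)‖ / ((Nat.totient (D₂ * k) : ℝ) * k) *
        ‖DeltaW D ((l : ℝ) / ((D₂ : ℝ) * p * k))‖ := fun k _ => tsum_nonneg fun l => by positivity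
  refine (norm_sum_le _ _).trans ?_
  refine le_trans (Finset.sum_le_sum fun k hk => ?_)
    (Finset.sum_le_sum_of_subset_of_nonneg (Finset.filter_subset _ _) fun k hk _ => hF0 k hk)
  have hk' : k ∈ Finset.Icc 1 ⌊2 * P4 D⌋₊ := (Finset.mem_filter.mp hk).1
  have hk1 : 1 ≤ k := (Finset.mem_Icc.mp hk').1
  have hDk : 0 < D₂ * k := Nat.mul_pos hD₂ hk1
  have hQ : (0 : ℝ) < (D₂ : ℝ) * p * k := by
    have : (0 : ℝ) < D₂ := by exact_mod_cast hD₂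
    have : (0 : ℝ) < p := by exact_mod_cast hprime.pos
    have : (0 : ℝ) < k := by exact_mod_cast hk1
    positivity
  -- the summable pieces
  have hs1 := summable_kappa_mul_DeltaW hD3 hκ (D₁ * d) hQ
    (g := fun l : ℕ => (1 : DirichletCharacter ℂ (D₂ * k)) (-(l : ZMod (D₂ * k)))) (G := 1)
    (fun l => DirichletCharacter.norm_le_one _ _)
  have hs2 := (summable_kappa_mul_DeltaW hD3 hκ (D₁ * d) hQ (g := fun _ : ℕ => (1 : ℂ)) (G := 1)
    (fun l => by simp)).norm
  have hs2' : Summable fun l : ℕ => ‖κs (D₁ * d * l)‖ * ‖DeltaW D ((l : ℝ) / ((D₂ : ℝ) * p * k))‖ := by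
    refine hs2.congr fun l => ?_
    simp only [norm_mul, mul_one]
  -- |τ(ψ̄⁰)| ≤ 1, |ψ̄⁰(p)| ≤ 1
  have hτ : ‖tauSum (D₂ * k) (1 : DirichletCharacter ℂ (D₂ * k))⁻¹‖ ≤ 1 := by
    rw [step14p78_holds (D₂ * k) hDk, Complex.norm_intCast]
    exact_mod_cast ArithmeticFunction.abs_moebius_le_one
  have h1p : ‖(1 : DirichletCharacter ℂ (D₂ * k))⁻¹ (p : ZMod (D₂ * k))‖ ≤ 1 :=
    DirichletCharacter.norm_le_one _ _
  rw [norm_mul, norm_mul, norm_mul, norm_div, norm_mul, Complex.norm_natCast, Complex.norm_natCast]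
  -- the series
  have hser : ‖∑' l : ℕ, κs (D₁ * d * l) * (1 : DirichletCharacter ℂ (D₂ * k)) (-(l : ZMod (D₂ * k))) *
      DeltaW D ((l : ℝ) / ((D₂ : ℝ) * p * k))‖ ≤
      ∑' l : ℕ, ‖κs (D₁ * d * l)‖ * ‖DeltaW D ((l : ℝ) / ((D₂ : ℝ) * p * k))‖ := by
    refine (norm_tsum_le_tsum_norm hs1.norm).trans (Summable.tsum_le_tsum (fun l => ?_) hs1.norm hs2')
    rw [norm_mul, norm_mul]
    calc ‖κs (D₁ * d * l)‖ * ‖(1 : DirichletCharacter ℂ (D₂ * k)) (-(l : ZMod (D₂ * k)))‖ *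
          ‖DeltaW D ((l : ℝ) / ((D₂ : ℝ) * p * k))‖
        ≤ ‖κs (D₁ * d * l)‖ * 1 * ‖DeltaW D ((l : ℝ) / ((D₂ : ℝ) * p * k))‖ := by
          gcongr; exact DirichletCharacter.norm_le_one _ _
      _ = _ := by rw [mul_one]
  have hrhs : ∑' l : ℕ, ‖κs (D₁ * d * l) * as (d * k)‖ / ((Nat.totient (D₂ * k) : ℝ) * k) *
        ‖DeltaW D ((l : ℝ) / ((D₂ : ℝ) * p * k))‖ =
      ‖as (d * k)‖ / ((k : ℝ) * Nat.totient (D₂ * k)) *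
        ∑' l : ℕ, ‖κs (D₁ * d * l)‖ * ‖DeltaW D ((l : ℝ) / ((D₂ : ℝ) * p * k))‖ := by
    rw [← tsum_mul_left]
    refine tsum_congr fun l => ?_
    rw [norm_mul]; ring
  rw [hrhs]
  have hw : 0 ≤ ‖as (d * k)‖ / ((k : ℝ) * Nat.totient (D₂ * k)) := by positivity
  have hS : 0 ≤ ∑' l : ℕ, ‖κs (D₁ * d * l)‖ * ‖DeltaW D ((l : ℝ) / ((D₂ : ℝ) * p * k))‖ :=
    tsum_nonneg fun l => by positivity
  calc ‖as (d * k)‖ / ((k : ℝ) * Nat.totient (D₂ * k)) *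
        (‖tauSum (D₂ * k) (1 : DirichletCharacter ℂ (D₂ * k))⁻¹‖ *
          ‖(1 : DirichletCharacter ℂ (D₂ * k))⁻¹ (p : ZMod (D₂ * k))‖ *
          ‖∑' l : ℕ, κs (D₁ * d * l) * (1 : DirichletCharacter ℂ (D₂ * k)) (-(l : ZMod (D₂ * k))) *
            DeltaW D ((l : ℝ) / ((D₂ : ℝ) * p * k))‖)
      ≤ ‖as (d * k)‖ / ((k : ℝ) * Nat.totient (D₂ * k)) *
        (1 * 1 * ∑' l : ℕ, ‖κs (D₁ * d * l)‖ * ‖DeltaW D ((l : ℝ) / ((D₂ : ℝ) * p * k))‖) := by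
        gcongr
    _ = _ := by rw [one_mul, one_mul]

/-- **The principal-character term of (14.7)′ is `≪ d(D₁)⁴·P·𝓛⁸⁴⁵`** (u013 twin at the modulus `D₂k`,
both `≪` combined), in the eventual form the assembly of (14.6) consumes: for every `B` there are
`C ≥ 0` and `D₀` such that for `D ≥ D₀`, every real primitive `χ (mod D)`, every `p ∼ P`, all `κ*, a*`
subject to (14.1)–(14.2) and every factorisation `D = D₁D₂`, the principal term has norm
`≤ C·d(D₁)⁴·P·𝓛⁸⁴⁵`. Assumption (A) is not used. [cite: Zhang2022LandauSiegel, §14 u013 p.78, (14.6) p.79] -/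
theorem princTerm₂_bound (B : ℝ) : ∃ C : ℝ, 0 ≤ C ∧ ∃ D₀ : ℕ, ∀ D : ℕ, D₀ ≤ D →
    ∀ (_ : NeZero D) (χ : DirichletCharacter ℂ D), χ.IsQuadratic → χ.IsPrimitive →
    ∀ p ∈ primeWindow D, ∀ κs as : ℕ → ℂ, Eq141 B κs → Eq142 D B as →
      ∀ D₁ D₂ : ℕ, D₁ * D₂ = D →
        ‖∑ d ∈ Finset.Icc 1 ⌊2 * P4 D⌋₊, (d : ℂ)⁻¹ *
            ∑ k ∈ (Finset.Icc 1 ⌊2 * P4 D⌋₊).filter (fun k => Nat.Coprime k D₁),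
              as (d * k) / ((k : ℂ) * Nat.totient (D₂ * k)) *
                (tauSum (D₂ * k) (1 : DirichletCharacter ℂ (D₂ * k))⁻¹ *
                    (1 : DirichletCharacter ℂ (D₂ * k))⁻¹ (p : ZMod (D₂ * k)) *
                  ∑' l : ℕ, κs (D₁ * d * l) *
                    (1 : DirichletCharacter ℂ (D₂ * k)) (-(l : ZMod (D₂ * k))) *
                      DeltaW D ((l : ℝ) / ((D₂ : ℝ) * p * k)))‖ ≤
          C * (D₁.divisors.card : ℝ) ^ 4 * bigP D * ell D ^ (845 : ℕ) := by
  obtain ⟨C, hC0, D₀, hmaj⟩ := major₂_le B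
  refine ⟨C, hC0, max D₀ 3, fun D hD _ χ hq hprim p hpW κs as h141 h142 D₁ D₂ hD₁₂ => ?_⟩
  have hD0 : D₀ ≤ D := le_trans (le_max_left _ _) hD
  have hD3 : 3 ≤ D := le_trans (le_max_right _ _) hD
  have hD₂1 : 1 ≤ D₂ := Nat.pos_of_ne_zero fun h => by subst h; omega
  have hD₂D : D₂ ≤ D := by
    have hD₁1 : 1 ≤ D₁ := Nat.pos_of_ne_zero fun h => by subst h; omega
    calc D₂ = 1 * D₂ := (one_mul _).symm
      _ ≤ D₁ * D₂ := Nat.mul_le_mul_right _ hD₁1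
      _ = D := hD₁₂
  exact (norm_princTerm₂_le_major₂ hD3 h141 as hpW D₁ D₂ hD₂1).trans
    (hmaj D hD0 inferInstance χ hq hprim p hpW κs as h141 h142 D₁ D₂ hD₂1 hD₂D)

end Literature.NumberTheory.LFunctions.Zhang2022.Typed.Sec14
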